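import Summits.KontsevichZagierPeriods.KontsevichZagierPeriods.Theorems.HyperbolicBlochFiveTermTransfer
import Summits.KontsevichZagierPeriods.KontsevichZagierPeriods.Theorems.HyperbolicBlochSectorReduction
import Summits.KontsevichZagierPeriods.KontsevichZagierPeriods.Theorems.BetaCancellation.Negative.Torsion

/-!
# `OffTetraSectorKernel` (stmt-KontsevichZagierPeriods-10557), line `odd-hyperbolic-ladder` v11: the `ℚ`-form of Zagier's conjecture suffices

Route `HyperbolicBloch` closes the summit from `TetraSector`, the crux `OffTetraSectorKernel` and ZAGIER'S CONJECTURE IN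
VOLUME/`ℤ`-FORM (`ZagierDilogarithmConjecture`: every `ℤ`-relation `Σ nᵢ vol T(zᵢ) = 0` lies in the `ℤ`-SPAN of the
five-term / conjugation / real relators). The printed conjecture (Zagier 2007, Ch. I §3; Neumann 1998, Conj. 2.9) is a
statement about `ℚ`-linear relations; the route file justifies the `ℤ`-form by the UNIQUE DIVISIBILITY of the Bloch
group of `ℚ̄` (Suslin; Dupont–Sah; Neumann 1998, Thm 2.10) — a deep theorem not in the tree. Skeleton v11 of this line
observes that it is not needed: `FormalRep ⧸ KZ.relations` is torsion-free (integer division is a derived rule of the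
calculus, `BetaCancellationNegative.mem_relations_of_nsmul_mem`), so the `ℚ`-FORM of Zagier's conjecture (`∃ N ≥ 1`,
`N·Σ nᵢ[zᵢ]` in the `ℤ`-span) already gives the sector statement (`tetraSector_of_rationalZagier`) and, with the crux,
the summit (`kontsevichZagierPeriods_of_rationalZagier`, the deciding theorem `closes` re-run with the weaker input).

References: D. Zagier, *The dilogarithm function* (2007), Ch. I §3; W. D. Neumann, *Hilbert's 3rd problem and invariants
of 3-manifolds* (1998), §2; J. L. Dupont, C.-H. Sah, *Scissors congruences II* (1982), §5; M. Kontsevich, D. Zagier,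
*Periods* (2001), §1.2.
-/

noncomputable section

open MeasureTheory Set Complex
open scoped ComplexConjugate BigOperators

namespace Summit.KontsevichZagierPeriods.HyperbolicBloch.OffTetraSectorKernel

open Literature.NumberTheory.Transcendental
open Literature.NumberTheory.Transcendental.KZ
open Summit.KontsevichZagierPeriods.KontsevichZagierPeriods.Theses.HyperbolicBloch
  (FiveTermTransfer TetraSector OffTetraSectorKernel ZagierDilogarithmConjecture)
open Summit.KontsevichZagierPeriods.HyperbolicBloch.SectorReduction
  (value_eq_setIntegral_of_eqOn B_add_B_conj_eq_zero B_eq_zero_of_im_eq_zero)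
open Summit.KontsevichZagierPeriods.HyperbolicBloch.FiveTerm (FiveTermTransfer_of)

/-- **The five-term span maps into `KZ.relations`, element by element** (the local form of
`SectorReduction`): for an admissible tetrahedral family `ρ` and the signed class map `B`, the additive extension
`φ = FreeAbelianGroup.lift B` sends the `ℤ`-span of the five-term / conjugation / real relators into `KZ.relations`
(`FiveTermTransfer_of` on the generators, `AddSubgroup.closure_le`). [cite: DupontSah1982, §5] -/
theorem rationalZagier_span_le_comap
    (T : ℂ → Set (Fin 3 → ℝ)) (hT : ∀ z, T z = {p | 0 < p 1 ∧ z.re * p 1 < z.im * p 0 ∧ z.im * (p 0 - 1) < (z.re - 1) * p 1 ∧ 0 < p 2 ∧ 0 < z.im * (p 0 ^ 2 + p 1 ^ 2 + p 2 ^ 2 - p 0) + (z.re - Complex.normSq z) * p 1})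
    (ρ : ℂ → IntegralRep 3) (hρ : ∀ z, IsAlgebraic ℚ z → 0 < z.im → (ρ z).domain = T z ∧
      Set.EqOn (ρ z).integrand (fun p => 1 / p 2 ^ 3) (T z))
    (B : ℂ → FormalRep) (hB : ∀ w, B w = if 0 < w.im then KZ.of (ρ w)
      else if w.im < 0 then -KZ.of (ρ (conj w)) else 0) :
    AddSubgroup.closure
      ({c : FreeAbelianGroup ℂ | ∃ x y : ℂ, IsAlgebraic ℚ x ∧ IsAlgebraic ℚ y ∧ x ≠ 0 ∧ x ≠ 1 ∧
          y ≠ 0 ∧ y ≠ 1 ∧ x ≠ y ∧ c = FreeAbelianGroup.of x - FreeAbelianGroup.of y +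
          FreeAbelianGroup.of (y / x) - FreeAbelianGroup.of ((1 - x⁻¹) / (1 - y⁻¹)) +
          FreeAbelianGroup.of ((1 - x) / (1 - y))} ∪
        {c | ∃ w : ℂ, IsAlgebraic ℚ w ∧ c = FreeAbelianGroup.of w +
          FreeAbelianGroup.of ((starRingEnd ℂ) w)} ∪
        {c | ∃ w : ℂ, w.im = 0 ∧ c = FreeAbelianGroup.of w}) ≤
      relations.comap (FreeAbelianGroup.lift B) := by
  have hφ : ∀ w, FreeAbelianGroup.lift B (FreeAbelianGroup.of w) = B w := fun w =>
    FreeAbelianGroup.lift_apply_of _ _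
  rw [AddSubgroup.closure_le]
  rintro c ((⟨x, y, hx, hy, hx0, hx1, hy0, hy1, hxy, rfl⟩ | ⟨w, -, rfl⟩) | ⟨w, hw, rfl⟩)
  · simp only [SetLike.mem_coe, AddSubgroup.mem_comap, map_add, map_sub, hφ]
    exact FiveTermTransfer_of T hT ρ hρ B hB x y hx hy hx0 hx1 hy0 hy1 hxy
  · simp only [SetLike.mem_coe, AddSubgroup.mem_comap, map_add, hφ]
    rw [B_add_B_conj_eq_zero ρ B hB w]
    exact zero_mem _
  · simp only [SetLike.mem_coe, AddSubgroup.mem_comap, hφ]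
    rw [B_eq_zero_of_im_eq_zero ρ B hB w hw]
    exact zero_mem _

/-- **The `ℚ`-form of Zagier's conjecture already gives the tetrahedral sector.** If every `ℤ`-relation among the
volumes of the standard ideal tetrahedra `T(zᵢ)` (`zᵢ ∈ ℚ̄ ∩ ℍ⁺`) has SOME POSITIVE MULTIPLE in the `ℤ`-span of the
five-term / conjugation / real relators (Zagier's conjecture as printed, a statement `⊗ ℚ`), then every value-relator
`Σ nᵢ [ρ zᵢ]` of an admissible tetrahedral family is a Kontsevich–Zagier relation: the multiple is one by
`rationalZagier_span_le_comap`, and `FormalRep ⧸ relations` is torsion-free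
(`BetaCancellationNegative.mem_relations_of_nsmul_mem`). No unique-divisibility theorem for the Bloch group is used.
[cite: Zagier2007Dilogarithm, Ch. I §3] -/
theorem tetraSector_of_rationalZagier :
    ∀ (T : ℂ → Set (Fin 3 → ℝ)), (∀ z, T z = {p | 0 < p 1 ∧ z.re * p 1 < z.im * p 0 ∧ z.im * (p 0 - 1) < (z.re - 1) * p 1 ∧ 0 < p 2 ∧ 0 < z.im * (p 0 ^ 2 + p 1 ^ 2 + p 2 ^ 2 - p 0) + (z.re - Complex.normSq z) * p 1}) →
    (∀ (k : ℕ) (z : Fin k → ℂ) (n : Fin k → ℤ), (∀ i, IsAlgebraic ℚ (z i)) → (∀ i, 0 < (z i).im) →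
      ∑ i, (n i : ℝ) * (∫ p in T (z i), 1 / p 2 ^ 3) = 0 → ∃ N : ℕ, N ≠ 0 ∧
      N • (∑ i, n i • FreeAbelianGroup.of (z i)) ∈ AddSubgroup.closure
        ({c : FreeAbelianGroup ℂ | ∃ x y : ℂ, IsAlgebraic ℚ x ∧ IsAlgebraic ℚ y ∧ x ≠ 0 ∧ x ≠ 1 ∧
            y ≠ 0 ∧ y ≠ 1 ∧ x ≠ y ∧ c = FreeAbelianGroup.of x - FreeAbelianGroup.of y +
            FreeAbelianGroup.of (y / x) - FreeAbelianGroup.of ((1 - x⁻¹) / (1 - y⁻¹)) +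
            FreeAbelianGroup.of ((1 - x) / (1 - y))} ∪
          {c | ∃ w : ℂ, IsAlgebraic ℚ w ∧ c = FreeAbelianGroup.of w +
            FreeAbelianGroup.of ((starRingEnd ℂ) w)} ∪
          {c | ∃ w : ℂ, w.im = 0 ∧ c = FreeAbelianGroup.of w})) →
    ∀ (ρ : ℂ → KZ.IntegralRep 3), (∀ z, IsAlgebraic ℚ z → 0 < z.im → (ρ z).domain = T z ∧
      Set.EqOn (ρ z).integrand (fun p => 1 / p 2 ^ 3) (T z)) →
    ∀ (k : ℕ) (z : Fin k → ℂ) (n : Fin k → ℤ), (∀ i, IsAlgebraic ℚ (z i)) → (∀ i, 0 < (z i).im) →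
      ∑ i, (n i : ℝ) * (ρ (z i)).value = 0 → (∑ i, n i • KZ.of (ρ (z i))) ∈ KZ.relations := by
  intro T hT hZ ρ hρ k z n halg him hsum
  -- values are volumes
  have hval : ∀ i, (ρ (z i)).value = ∫ p in T (z i), 1 / p 2 ^ 3 := fun i =>
    value_eq_setIntegral_of_eqOn (hρ (z i) (halg i) (him i)).1 (hρ (z i) (halg i) (him i)).2
  have hsum' : ∑ i, (n i : ℝ) * (∫ p in T (z i), 1 / p 2 ^ 3) = 0 := by
    simpa only [hval] using hsum
  obtain ⟨N, hN, hmem⟩ := hZ k z n halg him hsum'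
  -- the signed class map and its extension
  obtain ⟨B, hB⟩ : ∃ B : ℂ → FormalRep, ∀ w, B w = if 0 < w.im then KZ.of (ρ w)
      else if w.im < 0 then -KZ.of (ρ (conj w)) else 0 := ⟨_, fun _ => rfl⟩
  have hφ : ∀ w, FreeAbelianGroup.lift B (FreeAbelianGroup.of w) = B w := fun w =>
    FreeAbelianGroup.lift_apply_of _ _
  have hφsum : FreeAbelianGroup.lift B (∑ i, n i • FreeAbelianGroup.of (z i)) =
      ∑ i, n i • KZ.of (ρ (z i)) := by
    rw [map_sum]
    refine Finset.sum_congr rfl fun i _ => ?_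
    rw [map_zsmul, hφ, hB, if_pos (him i)]
  have h2 := rationalZagier_span_le_comap T hT ρ hρ B hB hmem
  rw [AddSubgroup.mem_comap, map_nsmul, hφsum] at h2
  exact Summit.KontsevichZagierPeriods.KontsevichZagierPeriods.BetaCancellationNegative.mem_relations_of_nsmul_mem hN h2

/-- The `ℤ`-form of Zagier's conjecture (route item `ZagierDilogarithmConjecture`) trivially implies its `ℚ`-form
(`N = 1`). [cite: Zagier2007Dilogarithm, Ch. I §3] -/
theorem rationalZagier_of_zagierDilogarithmConjecture (hZ : ZagierDilogarithmConjecture) :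
    ∀ (T : ℂ → Set (Fin 3 → ℝ)), (∀ z, T z = {p | 0 < p 1 ∧ z.re * p 1 < z.im * p 0 ∧ z.im * (p 0 - 1) < (z.re - 1) * p 1 ∧ 0 < p 2 ∧ 0 < z.im * (p 0 ^ 2 + p 1 ^ 2 + p 2 ^ 2 - p 0) + (z.re - Complex.normSq z) * p 1}) →
    ∀ (k : ℕ) (z : Fin k → ℂ) (n : Fin k → ℤ), (∀ i, IsAlgebraic ℚ (z i)) → (∀ i, 0 < (z i).im) →
      ∑ i, (n i : ℝ) * (∫ p in T (z i), 1 / p 2 ^ 3) = 0 → ∃ N : ℕ, N ≠ 0 ∧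
      N • (∑ i, n i • FreeAbelianGroup.of (z i)) ∈ AddSubgroup.closure
        ({c : FreeAbelianGroup ℂ | ∃ x y : ℂ, IsAlgebraic ℚ x ∧ IsAlgebraic ℚ y ∧ x ≠ 0 ∧ x ≠ 1 ∧
            y ≠ 0 ∧ y ≠ 1 ∧ x ≠ y ∧ c = FreeAbelianGroup.of x - FreeAbelianGroup.of y +
            FreeAbelianGroup.of (y / x) - FreeAbelianGroup.of ((1 - x⁻¹) / (1 - y⁻¹)) +
            FreeAbelianGroup.of ((1 - x) / (1 - y))} ∪
          {c | ∃ w : ℂ, IsAlgebraic ℚ w ∧ c = FreeAbelianGroup.of w +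
            FreeAbelianGroup.of ((starRingEnd ℂ) w)} ∪
          {c | ∃ w : ℂ, w.im = 0 ∧ c = FreeAbelianGroup.of w}) :=
  fun T hT k z n halg him hsum => ⟨1, one_ne_zero, by rw [one_smul]; exact hZ T hT k z n halg him hsum⟩

/-- **The route closes from the `ℚ`-form of Zagier's conjecture** (the deciding theorem `closes` of route
`HyperbolicBloch` re-run with the weaker conjectural input): `ℚ`-Zagier and the crux `OffTetraSectorKernel` give the
summit `KontsevichZagierPeriods` — each adjoined tetrahedral value-relator is a relation by
`tetraSector_of_rationalZagier`. [cite: KontsevichZagier2001, §1.2] -/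
theorem kontsevichZagierPeriods_of_rationalZagier
    (hZ : ∀ (T : ℂ → Set (Fin 3 → ℝ)), (∀ z, T z = {p | 0 < p 1 ∧ z.re * p 1 < z.im * p 0 ∧ z.im * (p 0 - 1) < (z.re - 1) * p 1 ∧ 0 < p 2 ∧ 0 < z.im * (p 0 ^ 2 + p 1 ^ 2 + p 2 ^ 2 - p 0) + (z.re - Complex.normSq z) * p 1}) →
      ∀ (k : ℕ) (z : Fin k → ℂ) (n : Fin k → ℤ), (∀ i, IsAlgebraic ℚ (z i)) → (∀ i, 0 < (z i).im) →
        ∑ i, (n i : ℝ) * (∫ p in T (z i), 1 / p 2 ^ 3) = 0 → ∃ N : ℕ, N ≠ 0 ∧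
        N • (∑ i, n i • FreeAbelianGroup.of (z i)) ∈ AddSubgroup.closure
          ({c : FreeAbelianGroup ℂ | ∃ x y : ℂ, IsAlgebraic ℚ x ∧ IsAlgebraic ℚ y ∧ x ≠ 0 ∧ x ≠ 1 ∧
              y ≠ 0 ∧ y ≠ 1 ∧ x ≠ y ∧ c = FreeAbelianGroup.of x - FreeAbelianGroup.of y +
              FreeAbelianGroup.of (y / x) - FreeAbelianGroup.of ((1 - x⁻¹) / (1 - y⁻¹)) +
              FreeAbelianGroup.of ((1 - x) / (1 - y))} ∪
            {c | ∃ w : ℂ, IsAlgebraic ℚ w ∧ c = FreeAbelianGroup.of w +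
              FreeAbelianGroup.of ((starRingEnd ℂ) w)} ∪
            {c | ∃ w : ℂ, w.im = 0 ∧ c = FreeAbelianGroup.of w}))
    (hO : OffTetraSectorKernel) : _root_.KontsevichZagierPeriods := by
  intro n m r r' _ _ hv
  have h0 : KZ.eval (KZ.of r - KZ.of r') = 0 := by
    simp [KZ.eval_of, hv]
  have hmem := hO _ (fun z => rfl) _ h0
  refine sup_le le_rfl ((AddSubgroup.closure_le _).mpr ?_) hmem
  rintro d ⟨ρ, hρ, k, z, nn, halg, him, hsum, rfl⟩
  exact tetraSector_of_rationalZagier _ (fun z => rfl) (hZ _ (fun z => rfl)) ρ hρ k z nn halg him hsum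

end Summit.KontsevichZagierPeriods.HyperbolicBloch.OffTetraSectorKernel

end
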